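import Literature.NumberTheory.ComplexMultiplication.FiniteQAlgebraLatticeLocalization
import HarnessLib

/-!
# LOCAL UNITS of an order `Λ` in an ARBITRARY finite-dimensional commutative `ℚ`-algebra `A` — `a ∈ Λ` is a unit of
# `Λ_(p)` iff `a + pΛ` is a unit of `Λ/pΛ`, in particular `1 + pΛ ⊂ Λ_(p)^×` (Hertling–Larabi 2026 Lemma 7.5 (b),
# Remarks 7.7, by Nakayama's lemma) — and the first steps of §8: `𝒪(L_1L_2) = 𝒪(L_1)`, `L_1:L_2 = L_1L_2⁻¹`,
# `𝒪(L_1:L_2) = 𝒪(L_1)` for `𝒪(L_1) ⊇ 𝒪(L_2)`, `L_2` invertible; `L ∈ G(Λ_2) ⟹ Λ_1L ∈ G(Λ_1)`; the CONDUCTOR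
# `C = Λ_2:Λ_1` of a pair of orders is the biggest `Λ_1`-ideal in `Λ_2` (Hertling–Larabi 2026 Lemma 8.1,
# Thm. 8.2 (a); Neukirch I §12) — nilpotents allowed

[topic NumberTheory/ComplexMultiplication] General-`A` series (namespace
`Literature.NumberTheory.ComplexMultiplication.FiniteQAlgebraLattice`), the general-`A` twin of the `Y = L_1 ⊕ ⋯ ⊕ L_t`
file `CMAlgebraLatticeLocalUnits` (seat p19 gen 32), whose proofs use nothing of `Y` beyond its ring structure;
sequel of `FiniteQAlgebraLatticeLocalization` (the def-free localisations «`x ∈ L_(p)`» =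
`∃ s : ℤ, ¬ ↑p ∣ s ∧ s • x ∈ L`, «`L_1`, `L_2` agree at `p`») and of `FiniteQAlgebraLatticeWeakEquivalence` ∕
`FiniteQAlgebraLatticeMetricDual` (orders `𝒪(L) = L/L`, «invertible» = `L·((L/L)/L) = L/L`, `L⁻¹ = (L/L)/L` with
`𝒪(L⁻¹) = 𝒪(L)`: `div_div_div_eq_of_mul_div_div_eq`, `div_mul_inv_eq_of_one_mem`, `one_mem_div_mul_div_order_iff`,
`div_mul_div_le`, `div_mul_div_self_eq` — REUSED by name).  Lane `lit-hodgefound` (Track 2 foundations library), seat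
p19 generation 36, row g36-#7.  THEOREMS ONLY: no definition, no instance, no notation, no named fact (D-0026, net
Literature debt `0`), no `sorry`.  Fullness (`IsFullLattice A Λ`) enters only through the finite generation needed
by Nakayama's lemma; `ℚ` only through «a local unit is a unit of `A`»; everything else holds for `ℤ`-submodules of
any commutative ring.

DEF-FREE SPELLING (continued).  For `a ∈ Λ`: «`a ∈ Λ_(p)^{unit}`» is written `∃ b ∈ Λ, ∃ r : ℤ, ¬ ↑p ∣ r ∧
a·b = r·1` (the inverse is `b/r ∈ Λ_(p)`), and «`a + pΛ ∈ (Λ/pΛ)^{unit}`» is written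
`∃ b ∈ Λ, ∃ c ∈ Λ, a·b = 1 + p·c`.

## Source, VERBATIM

C. Hertling, K. Larabi, *Semigroups from full lattices in commutative ℚ-algebras*, arXiv:2602.14973 (2026)
[HertlingLarabi2026], held `paper:arxiv-2602.14973` — `A` «a finite dimensional commutative ℚ-algebra with unit
element» (Thm. 3.1), not assumed separable.  §7 (chunks p0018–p0020): «**Lemma 7.5.** Let `A` be as in Theorem 3.1.
Let `Λ` be an order in `A`. Let `p ∈ ℙ` be a prime number. […] (a) Consider an element `a ∈ Λ_(p)`. Then
`a ∈ Λ_(p)^{unit} ⟺ det(a) ∈ ℤ_(p)^{unit}`. (b) Consider an element `a ∈ Λ`. Then `a ∈ Λ_(p)^{unit} ⟺ a + pΛ ∈ Λ/pΛ`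
is in `(Λ/pΛ)^{unit}`. […] **Remarks 7.7.** If in the proof of Theorem 7.6 `L ⊂ pΛ` then `J_1 = ∅` and `a_3 = a_2`
in the proof. Then any preimage in `Λ` of a class in `(Λ/L)^{unit}` is in `Λ_(p)^{unit}`.»  §8 (chunk p0021):
«**Lemma 8.1.** (a) Let `L_1, L_2 ∈ 𝓛(A)` with `𝒪(L_1) ⊃ 𝒪(L_2)` and `L_2` invertible. Then `𝒪(L_1L_2) = 𝒪(L_1)`,
`L_1:L_2 = L_1L_2⁻¹`, `𝒪(L_1:L_2) = 𝒪(L_1)`. (b) Let `Λ_1` and `Λ_2 ∈ 𝓛(A)` be two orders with `Λ_2 ⊊ Λ_1`. If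
`L ∈ G(Λ_2)` then `Λ_1L ∈ G(Λ_1)`. This leads to group homomorphisms `G(Λ_2) → G(Λ_1), L ↦ Λ_1L`,
`G([Λ_2]_ε) → G([Λ_1]_ε), [L]_ε ↦ [Λ_1L]_ε`. *Proof:* (a) Suppose `a ∈ 𝒪(L_1L_2)`. Then
`aL_1 = aL_1𝒪(L_2) = aL_1L_2L_2⁻¹ ⊂ L_1L_2L_2⁻¹ = L_1𝒪(L_2) = L_1`, so `a ∈ 𝒪(L_1)`, so `𝒪(L_1L_2) ⊂ 𝒪(L_1)`.
Equality follows with (5.3). By definition of `L_1:L_2`, we have `(L_1:L_2)L_2 ⊂ L_1`. This gives `⊂` in the next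
formula, the first `=` comes from (5.3), `L_1:L_2 = (L_1:L_2)𝒪(L_2) = (L_1:L_2)L_2L_2⁻¹ ⊂ L_1L_2⁻¹`.
`L_1:L_2 ⊃ L_1L_2⁻¹` is true because `𝒪(L_2) ⊂ 𝒪(L_1)`. We obtain `L_1:L_2 = L_1L_2⁻¹`. Finally
`𝒪(L_1L_2⁻¹) = 𝒪(L_1)` because `L_2⁻¹` is invertible with `𝒪(L_2⁻¹) = 𝒪(L_2) ⊂ 𝒪(L_1)`. (b) `(Λ_1L)L⁻¹ = Λ_1Λ_2
= Λ_1` and `Λ_1(Λ_1L) = Λ_1L` show that `Λ_1L` is invertible with `𝒪(Λ_1L) = Λ_1`. […] **Theorem 8.2.** Let `Λ_1`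
and `Λ_2` be two orders in `A` with `Λ_2 ⊊ Λ_1`. The full lattice `C := Λ_2:Λ_1` is called conductor of the pair
`(Λ_1, Λ_2)`. […] (a) `𝒪(C) ⊃ Λ_1`. The conductor `C` is the biggest `Λ_1`-ideal in `Λ_2`. […] *Proof:* (a)
`𝒪(C) ⊃ Λ_1` follows from (5.3). So `C` is a `Λ_1`-ideal. Any `Λ_1`-ideal in `Λ_2` is contained in `Λ_2:Λ_1 = C`. On
the other hand, `1_A ∈ Λ_1` implies `C = C·1_A ⊂ C·Λ_1 ⊂ Λ_2`.»  J. Neukirch, *Algebraic Number Theory*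
[NeukirchANT1999], Ch. I §12, p. 79: «the conductor of `𝒪` … is the biggest ideal of `𝒪_K` which is contained in
`𝒪`.»

## What is proved (`Λ, Λⱼ, Lⱼ, M : Submodule ℤ A`; `Λ` an order: `1 ∈ Λ`, `ΛΛ ⊆ Λ`, full where Nakayama needs it;
## `p : ℕ` prime)

* §1 LEMMA 7.5 (b) «⇐» ∕ REMARKS 7.7 by NAKAYAMA'S LEMMA (instead of HL's determinant ∕ Cayley–Hamilton route
  of 7.5 (a)): **`exists_mem_mul_eq_smul_one_of_one_add`** — for `c ∈ Λ` the element `1 + pc` is a unit of `Λ_(p)`: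
  `(1 + pc)·b = r·1` with `b ∈ Λ`, `p ∤ r` (Nakayama for the ideal `pℤ` on the finitely generated module
  `Λ/(1+pc)Λ`, on which `p` acts surjectively); **`exists_mem_mul_eq_smul_one_of_mul_eq_one_add`** (`ab = 1 + pc`
  with `b, c ∈ Λ` ⟹ `a ∈ Λ_(p)^{unit}`: «any preimage in `Λ` of a class in `(Λ/pΛ)^{unit}` is in `Λ_(p)^{unit}`»).
* §2 LEMMA 7.5 (b) «⇒» **`exists_mem_mul_eq_one_add_of_mul_eq_smul_one`** (`ab = r·1`, `p ∤ r` ⟹ `ab′ = 1 + pc`: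
  invert `r` modulo `p`), the packaged equivalence **`exists_mul_eq_smul_one_iff_exists_mul_eq_one_add`**, and
  bookkeeping: `isUnit_of_mul_eq_smul_one` (a local unit is a unit of the `ℚ`-algebra `A`),
  `exists_mul_mul_eq_smul_one` (local units are closed under products), `locEq_units_smul_of_mul_eq_smul_one` (for a
  local unit `a ∈ Λ`, `aΛ` and `Λ` agree at `p` — the trivial half of Thm. 8.2 (b) Step 4 «`a_p(Λ_2)_(p) = (Λ_2)_(p)`
  is equivalent to `a_p ∈ (Λ_2)_(p)^{unit}`»).
* §3 LEMMA 8.1 (a) (any commutative ring): `mul_div_self_eq_self_of_div_self_le` (`L_1𝒪(L_2) = L_1`),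
  **`div_self_mul_eq_of_div_self_le`** (`𝒪(L_1L_2) = 𝒪(L_1)`), **`div_eq_mul_inv_of_div_self_le`**
  (`L_1:L_2 = L_1L_2⁻¹`), **`div_self_div_eq_of_div_self_le`** (`𝒪(L_1:L_2) = 𝒪(L_1)`); LEMMA 8.1 (b)
  **`div_self_order_mul_eq_of_le`** (`Λ_2 ⊆ Λ_1` orders, `L ∈ G(Λ_2)` ⟹ `𝒪(Λ_1L) = Λ_1` and `Λ_1L` invertible — by
  (a) and HL's «`(Λ_1L)L⁻¹ = Λ_1Λ_2 = Λ_1`», no fullness needed) with its `ε`-class form `units_smul_order_mul`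
  (`Λ_1(uL) = u(Λ_1L)`).
* §4 THEOREM 8.2 (a), the CONDUCTOR `C = Λ_2:Λ_1`: `le_div_self_conductor` (`Λ_1 ⊆ 𝒪(C)`), `conductor_le`
  (`C ⊆ Λ_2`), `conductor_mul_le` (`Λ_1C ⊆ C`), **`le_conductor_of_mul_le`** («the biggest `Λ_1`-ideal in `Λ_2`»),
  `conductor_eq_self_iff` (`C = Λ_2 ⟺ Λ_1 = Λ_2`, given `Λ_2 ⊆ Λ_1`).
NOT here: Lemma 7.5 (a) (the determinant criterion), Thm. 7.6, Thm. 8.2 (b)–(f) (the exact sequences need Thm. 7.3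
«⇒»; `Y`-files `CMAlgebraLatticeLocallyPrincipal`, `…OrderExtensionKernel`, `…PicardExtensionSurjective`).

## References
* [HertlingLarabi2026] C. Hertling, K. Larabi, arXiv:2602.14973 (2026), §7 Lemma 7.5, Rem. 7.7 (chunks p0019–p0020);
  §8 Lemma 8.1, Thm. 8.2 (a) (chunk p0021). [cite: HertlingLarabi2026, §7 Lemma 7.5 and §8 Lemma 8.1, chunks p0019, p0021]
* [NeukirchANT1999] J. Neukirch, *Algebraic Number Theory*, Springer (1999), Ch. I §12 (conductor; (12.9)–(12.12)),
  pp. 78–80. [cite: NeukirchANT1999, Ch. I §12, p. 79]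
* [Faddeev1965] D. K. Faddeev, Trudy Mat. Inst. Steklov 80 (1965) 145–182 (the localisations `Λ_(p)`, as cited by
  HL §7). [cite: Faddeev1965, as cited by HertlingLarabi2026 §7]
-/

noncomputable section

open scoped Pointwise
open Module

open Literature.NumberTheory.Automorphic (IsFullLattice mem_units_smul_submodule_iff)

namespace Literature.NumberTheory.ComplexMultiplication.FiniteQAlgebraLattice

section LocalUnits

variable {A : Type} [CommRing A] [Algebra ℚ A]

/-! ## §1 Lemma 7.5 (b) «⇐» and Remarks 7.7: `1 + pΛ ⊂ Λ_(p)^{unit}`, by Nakayama's lemma -/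

omit [Algebra ℚ A] in
/-- **REMARKS 7.7 ∕ LEMMA 7.5 (b) «⇐», core case: for an order `Λ` and `c ∈ Λ`, the element `u = 1 + pc` is a UNIT
of `Λ_(p)` — `u·b = r·1` for some `b ∈ Λ` and an integer `r` prime to `p`.**  Proof by NAKAYAMA: `Λ = uΛ + pΛ`, so
the finitely generated `ℤ`-module `Λ/uΛ` equals `p·(Λ/uΛ)`, hence is killed by some `r ≡ 1 (mod p)`; `r·1 ∈ uΛ`.
(HL derive 7.5 (b) from the determinant criterion 7.5 (a) and Cayley–Hamilton; the conclusion is the same.)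
[cite: HertlingLarabi2026, §7 Lemma 7.5 (b) and Rem. 7.7, chunks p0019–p0020] -/
theorem exists_mem_mul_eq_smul_one_of_one_add {Λ : Submodule ℤ A} (hΛ : IsFullLattice A Λ)
    (h1 : (1 : A) ∈ Λ) (hΛΛ : Λ * Λ ≤ Λ) {p : ℕ} (hp : p.Prime) {c : A} (hc : c ∈ Λ) :
    ∃ b ∈ Λ, ∃ r : ℤ, ¬ (p : ℤ) ∣ r ∧ (1 + (p : ℤ) • c) * b = r • (1 : A) := by
  -- `T = uΛ ⊂ Y`, `N = Λ/uΛ ⊂ Y/uΛ`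
  let T : Submodule ℤ A := Λ.map (LinearMap.mulLeft ℤ (1 + (p : ℤ) • c))
  have hN : (Λ.map T.mkQ).FG := hΛ.1.map _
  -- `N ⊆ p·N`: `x = ux - p(cx)`
  have hle : Λ.map T.mkQ ≤ (Ideal.span {(p : ℤ)}) • Λ.map T.mkQ := by
    rintro _ ⟨x, hx, rfl⟩
    have hxT : x - (p : ℤ) • (-(c * x)) ∈ T :=
      ⟨x, hx, by rw [LinearMap.mulLeft_apply, smul_neg, sub_neg_eq_add, add_mul, one_mul, smul_mul_assoc]⟩
    have e1 : T.mkQ x = T.mkQ ((p : ℤ) • (-(c * x))) := by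
      rw [← sub_eq_zero, ← map_sub, Submodule.mkQ_apply, Submodule.Quotient.mk_eq_zero]
      exact hxT
    rw [e1, map_smul]
    exact Submodule.smul_mem_smul (Ideal.mem_span_singleton_self _)
      ⟨-(c * x), Λ.neg_mem (hΛΛ (Submodule.mul_mem_mul hc hx)), rfl⟩
  obtain ⟨r, hr1, hr0⟩ := Submodule.exists_sub_one_mem_and_smul_eq_zero_of_fg_of_le_smul _ _ hN hle
  -- `r·1 ∈ uΛ`
  have h0 : T.mkQ (r • (1 : A)) = 0 := by
    rw [map_smul]
    exact hr0 _ ⟨1, h1, rfl⟩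
  rw [Submodule.mkQ_apply, Submodule.Quotient.mk_eq_zero] at h0
  obtain ⟨b, hb, hub⟩ := h0
  refine ⟨b, hb, r, fun hpr => ?_, by rw [LinearMap.mulLeft_apply] at hub; exact hub⟩
  -- `p ∣ r` and `p ∣ r - 1` are incompatible
  rw [Ideal.mem_span_singleton] at hr1
  have h1' : (p : ℤ) ∣ r - (r - 1) := dvd_sub hpr hr1
  rw [sub_sub_cancel] at h1'
  exact (Nat.prime_iff_prime_int.1 hp).not_dvd_one h1'

omit [Algebra ℚ A] in
/-- **LEMMA 7.5 (b) «⇐» ∕ REMARKS 7.7: «any preimage in `Λ` of a class in `(Λ/pΛ)^{unit}` is in `Λ_(p)^{unit}`» — if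
`ab = 1 + pc` with `b, c ∈ Λ`, then `ab′ = r·1` for some `b′ ∈ Λ` and an integer `r` prime to `p`.**
[cite: HertlingLarabi2026, §7 Lemma 7.5 (b) ⇐ and Rem. 7.7, chunks p0019–p0020] -/
theorem exists_mem_mul_eq_smul_one_of_mul_eq_one_add {Λ : Submodule ℤ A}
    (hΛ : IsFullLattice A Λ) (h1 : (1 : A) ∈ Λ) (hΛΛ : Λ * Λ ≤ Λ) {p : ℕ} (hp : p.Prime)
    {a b c : A} (hb : b ∈ Λ) (hc : c ∈ Λ) (habc : a * b = 1 + (p : ℤ) • c) :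
    ∃ b' ∈ Λ, ∃ r : ℤ, ¬ (p : ℤ) ∣ r ∧ a * b' = r • (1 : A) := by
  obtain ⟨b₁, hb₁, r, hr, h⟩ := exists_mem_mul_eq_smul_one_of_one_add hΛ h1 hΛΛ hp hc
  exact ⟨b * b₁, hΛΛ (Submodule.mul_mem_mul hb hb₁), r, hr, by rw [← mul_assoc, habc, h]⟩

/-! ## §2 Lemma 7.5 (b) «⇒» and bookkeeping for local units -/

omit [Algebra ℚ A] in
/-- **LEMMA 7.5 (b) «⇒»: a unit of `Λ_(p)` lying in `Λ` is a unit modulo `pΛ` — `ab = r·1` with `b ∈ Λ`, `p ∤ r`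
⟹ `ab′ = 1 + pc` with `b′, c ∈ Λ`** (`yr = 1 − xp`, `b′ = yb`, `c = −x·1`). [cite: HertlingLarabi2026, §7 Lemma 7.5 (b) ⇒, chunk p0019] -/
theorem exists_mem_mul_eq_one_add_of_mul_eq_smul_one {Λ : Submodule ℤ A} (h1 : (1 : A) ∈ Λ)
    {p : ℕ} (hp : p.Prime) {a b : A} (hb : b ∈ Λ) {r : ℤ} (hr : ¬ (p : ℤ) ∣ r)
    (hab : a * b = r • (1 : A)) :
    ∃ b' ∈ Λ, ∃ c ∈ Λ, a * b' = 1 + (p : ℤ) • c := by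
  obtain ⟨x, y, hxy⟩ := ((Nat.prime_iff_prime_int.1 hp).coprime_iff_not_dvd.2 hr : IsCoprime (p : ℤ) r)
  refine ⟨y • b, Λ.smul_mem y hb, (-x) • 1, Λ.smul_mem _ h1, ?_⟩
  rw [mul_smul_comm, hab, smul_smul]
  have e : y * r = 1 - x * p := by rw [← hxy]; ring
  rw [e]
  simp only [zsmul_eq_mul, Int.cast_sub, Int.cast_mul, Int.cast_one, Int.cast_natCast, Int.cast_neg]
  ring

omit [Algebra ℚ A] in
/-- **LEMMA 7.5 (b): for an order `Λ`, a prime `p` and `a ∈ Y`, `a` is a unit of `Λ_(p)` with an inverse `b/r`,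
`b ∈ Λ`, iff `a` is a unit modulo `pΛ` with an inverse in `Λ`** (both directions above).
[cite: HertlingLarabi2026, §7 Lemma 7.5 (b), chunk p0019] -/
theorem exists_mul_eq_smul_one_iff_exists_mul_eq_one_add {Λ : Submodule ℤ A}
    (hΛ : IsFullLattice A Λ) (h1 : (1 : A) ∈ Λ) (hΛΛ : Λ * Λ ≤ Λ) {p : ℕ} (hp : p.Prime)
    (a : A) :
    (∃ b ∈ Λ, ∃ r : ℤ, ¬ (p : ℤ) ∣ r ∧ a * b = r • (1 : A)) ↔
      ∃ b ∈ Λ, ∃ c ∈ Λ, a * b = 1 + (p : ℤ) • c :=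
  ⟨fun ⟨_, hb, _, hr, hab⟩ => exists_mem_mul_eq_one_add_of_mul_eq_smul_one h1 hp hb hr hab,
    fun ⟨_, hb, _, hc, habc⟩ => exists_mem_mul_eq_smul_one_of_mul_eq_one_add hΛ h1 hΛΛ hp hb hc habc⟩

/-- **A local unit is a unit of `A`**: `ab = r·1` with `r ≠ 0` ⟹ `a ∈ Y^×` (`r·1` is a unit of the
`ℚ`-algebra `A`). [cite: HertlingLarabi2026, §7 Lemma 7.5 («`Λ_(p)^{unit}`»), chunk p0019] -/
theorem isUnit_of_mul_eq_smul_one {a b : A} {r : ℤ} (hr : r ≠ 0) (hab : a * b = r • (1 : A)) :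
    IsUnit a := by
  have hru : IsUnit (r • (1 : A)) := by
    rw [zsmul_eq_mul, mul_one, ← map_intCast (algebraMap ℚ A) r]
    exact (((Int.cast_ne_zero (α := ℚ)).2 hr).isUnit).map _
  rw [← hab] at hru
  exact isUnit_of_mul_isUnit_left hru

omit [Algebra ℚ A] in
/-- Local units are closed under PRODUCTS: `ab = r·1`, `a′b′ = r′·1 ⟹ (aa′)(bb′) = (rr′)·1` (and `p ∤ rr′`).
[cite: HertlingLarabi2026, §7 Lemma 7.5, chunk p0019] -/
theorem exists_mul_mul_eq_smul_one {Λ : Submodule ℤ A} (hΛΛ : Λ * Λ ≤ Λ) {p : ℕ} (hp : p.Prime)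
    {a a' : A} (ha : ∃ b ∈ Λ, ∃ r : ℤ, ¬ (p : ℤ) ∣ r ∧ a * b = r • (1 : A))
    (ha' : ∃ b ∈ Λ, ∃ r : ℤ, ¬ (p : ℤ) ∣ r ∧ a' * b = r • (1 : A)) :
    ∃ b ∈ Λ, ∃ r : ℤ, ¬ (p : ℤ) ∣ r ∧ (a * a') * b = r • (1 : A) := by
  obtain ⟨b, hb, r, hr, hab⟩ := ha
  obtain ⟨b', hb', r', hr', hab'⟩ := ha'
  refine ⟨b * b', hΛΛ (Submodule.mul_mem_mul hb hb'), r * r',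
    fun h => ((Nat.prime_iff_prime_int.1 hp).dvd_or_dvd h).elim hr hr', ?_⟩
  calc a * a' * (b * b') = (a * b) * (a' * b') := by ring
    _ = (r * r') • (1 : A) := by rw [hab, hab']; simp only [zsmul_eq_mul, Int.cast_mul]; ring

omit [Algebra ℚ A] in
/-- **For a local unit `a ∈ Λ`, `aΛ` and `Λ` AGREE AT `p`: `(aΛ)_(p) = Λ_(p)`** (with the multiplier `r`; the easy half of «`a_p(Λ_2)_(p) = (Λ_2)_(p)` is equivalent to `a_p ∈ (Λ_2)_(p)^{unit}`», Thm. 8.2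
(b) Step 4). [cite: HertlingLarabi2026, §8 Thm. 8.2 (b) (proof, Step 4), chunk p0022] -/
theorem locEq_units_smul_of_mul_eq_smul_one {Λ : Submodule ℤ A} (hΛΛ : Λ * Λ ≤ Λ) {p : ℕ}
    {a b : A} (haΛ : a ∈ Λ) (hb : b ∈ Λ) {r : ℤ} (hr : ¬ (p : ℤ) ∣ r)
    (hab : a * b = r • (1 : A)) (ha : IsUnit a) :
    ∃ s : ℤ, ¬ (p : ℤ) ∣ s ∧ (∀ x ∈ Λ, s • x ∈ ha.unit • Λ) ∧ (∀ x ∈ ha.unit • Λ, s • x ∈ Λ) := by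
  refine ⟨r, hr, fun x hx => ?_, fun x hx => ?_⟩
  · -- `r·x = a(bx)`
    rw [mem_units_smul_submodule_iff, Units.smul_def]
    have e : ((ha.unit⁻¹ : Aˣ) : A) • (r • x) = b * x := by
      have h2 : ((ha.unit⁻¹ : Aˣ) : A) * a = 1 := ha.val_inv_mul
      calc ((ha.unit⁻¹ : Aˣ) : A) • (r • x)
          = ((ha.unit⁻¹ : Aˣ) : A) * ((r • (1 : A)) * x) := by
            rw [smul_eq_mul, zsmul_eq_mul, zsmul_eq_mul, mul_one]
        _ = (((ha.unit⁻¹ : Aˣ) : A) * a) * (b * x) := by rw [← hab]; ring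
        _ = b * x := by rw [h2, one_mul]
    rw [e]
    exact hΛΛ (Submodule.mul_mem_mul hb hx)
  · -- `x = ay ∈ Λ`
    rw [mem_units_smul_submodule_iff, Units.smul_def] at hx
    have e : x = a * (((ha.unit⁻¹ : Aˣ) : A) • x) := by
      rw [smul_eq_mul, ← mul_assoc, IsUnit.mul_val_inv, one_mul]
    rw [e]
    exact Λ.smul_mem r (hΛΛ (Submodule.mul_mem_mul haΛ hx))

/-! ## §3 Lemma 8.1: `𝒪(L_1L_2) = 𝒪(L_1)`, `L_1:L_2 = L_1L_2⁻¹`; `G(Λ_2) → G(Λ_1)`, `L ↦ Λ_1L` -/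

omit [Algebra ℚ A] in
/-- `L_1𝒪(L_2) = L_1` when `𝒪(L_2) ⊆ 𝒪(L_1)`. [cite: HertlingLarabi2026, §8 Lemma 8.1 (proof of (a): «`L_1𝒪(L_2) = L_1`»), chunk p0021] -/
theorem mul_div_self_eq_self_of_div_self_le {L₁ L₂ : Submodule ℤ A} (h : L₂ / L₂ ≤ L₁ / L₁) :
    L₁ * (L₂ / L₂) = L₁ := by
  refine le_antisymm ?_ fun x hx => ?_
  · calc L₁ * (L₂ / L₂) ≤ L₁ * (L₁ / L₁) := mul_le_mul_right h _
      _ = L₁ := by rw [mul_comm, div_self_mul_eq_self]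
  · rw [← mul_one x]
    exact Submodule.mul_mem_mul hx (one_mem_div_self L₂)

omit [Algebra ℚ A] in
/-- **LEMMA 8.1 (a): `𝒪(L_1L_2) = 𝒪(L_1)` for `𝒪(L_1) ⊇ 𝒪(L_2)` and `L_2` INVERTIBLE** («`aL_1 = aL_1𝒪(L_2) =
aL_1L_2L_2⁻¹ ⊂ L_1L_2L_2⁻¹ = L_1𝒪(L_2) = L_1`»; the inclusion `⊇` is (5.3)). [cite: HertlingLarabi2026, §8 Lemma 8.1 (a), chunk p0021] -/
theorem div_self_mul_eq_of_div_self_le {L₁ L₂ : Submodule ℤ A} (h : L₂ / L₂ ≤ L₁ / L₁)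
    (hinv : L₂ * ((L₂ / L₂) / L₂) = L₂ / L₂) : (L₁ * L₂) / (L₁ * L₂) = L₁ / L₁ := by
  -- `L_1 = (L_1L_2)L_2⁻¹`
  have key : L₁ = (L₁ * L₂) * ((L₂ / L₂) / L₂) := by
    rw [mul_assoc, hinv, mul_div_self_eq_self_of_div_self_le h]
  refine le_antisymm (fun a ha => Submodule.mem_div_iff_forall_mul_mem.2 fun m hm => ?_) fun a ha => ?_
  · rw [key] at hm ⊢
    rw [Submodule.mem_div_iff_forall_mul_mem] at ha
    refine Submodule.mul_induction_on hm (fun y hy z hz => ?_) (fun y z hy hz => ?_)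
    · rw [← mul_assoc]
      exact Submodule.mul_mem_mul (ha y hy) hz
    · rw [mul_add]
      exact Submodule.add_mem _ hy hz
  · have h1 : a * 1 ∈ (L₁ / L₁) * (L₂ / L₂) := Submodule.mul_mem_mul ha (one_mem_div_self L₂)
    rw [mul_one] at h1
    exact div_mul_div_le L₁ L₁ L₂ L₂ h1

omit [Algebra ℚ A] in
/-- **LEMMA 8.1 (a): `L_1:L_2 = L_1L_2⁻¹` for `𝒪(L_1) ⊇ 𝒪(L_2)` and `L_2` INVERTIBLE** (`L_2⁻¹ = 𝒪(L_2):L_2`; «`L_1:L_2 =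
(L_1:L_2)𝒪(L_2) = (L_1:L_2)L_2L_2⁻¹ ⊂ L_1L_2⁻¹`», and `L_1L_2⁻¹L_2 = L_1𝒪(L_2) = L_1`).
[cite: HertlingLarabi2026, §8 Lemma 8.1 (a), chunk p0021] -/
theorem div_eq_mul_inv_of_div_self_le {L₁ L₂ : Submodule ℤ A} (h : L₂ / L₂ ≤ L₁ / L₁)
    (hinv : L₂ * ((L₂ / L₂) / L₂) = L₂ / L₂) : L₁ / L₂ = L₁ * ((L₂ / L₂) / L₂) := by
  refine le_antisymm ?_ (Submodule.le_div_iff_mul_le.2 (le_of_eq ?_))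
  · calc L₁ / L₂ = (L₁ / L₂) * (L₂ / L₂) := (div_mul_div_self_eq L₁ L₂).symm
      _ = ((L₁ / L₂) * L₂) * ((L₂ / L₂) / L₂) := by rw [mul_assoc, hinv]
      _ ≤ L₁ * ((L₂ / L₂) / L₂) := mul_le_mul_left (Submodule.le_div_iff_mul_le.1 le_rfl) _
  · rw [mul_assoc, mul_comm ((L₂ / L₂) / L₂) L₂, hinv, mul_div_self_eq_self_of_div_self_le h]

omit [Algebra ℚ A] in
/-- **LEMMA 8.1 (a): `𝒪(L_1:L_2) = 𝒪(L_1)` for `𝒪(L_1) ⊇ 𝒪(L_2)` and `L_2` INVERTIBLE** (`L_1:L_2 = L_1L_2⁻¹` and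
`L_2⁻¹` is invertible with `𝒪(L_2⁻¹) = 𝒪(L_2) ⊆ 𝒪(L_1)`). [cite: HertlingLarabi2026, §8 Lemma 8.1 (a), chunk p0021] -/
theorem div_self_div_eq_of_div_self_le {L₁ L₂ : Submodule ℤ A} (h : L₂ / L₂ ≤ L₁ / L₁)
    (hinv : L₂ * ((L₂ / L₂) / L₂) = L₂ / L₂) : (L₁ / L₂) / (L₁ / L₂) = L₁ / L₁ := by
  -- `L_2⁻¹ = 𝒪(L_2):L_2` is invertible with `𝒪(L_2⁻¹) = 𝒪(L_2)` (`L_2 ∼_w 𝒪(L_2)`, Thm. 5.7 (b))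
  have hw : (1 : A) ∈ ((L₂ / L₂) / L₂) * (L₂ / (L₂ / L₂)) := by
    rw [one_mem_div_mul_div_comm]
    exact (one_mem_div_mul_div_order_iff (one_mem_div_self L₂) (div_self_mul_div_self L₂).le).2 ⟨rfl, hinv⟩
  have hO : ((L₂ / L₂) / L₂) / ((L₂ / L₂) / L₂) = L₂ / L₂ := div_div_div_eq_of_mul_div_div_eq hinv
  have hinv' := div_mul_inv_eq_of_one_mem hw
  rw [div_eq_mul_inv_of_div_self_le h hinv]
  exact div_self_mul_eq_of_div_self_le (by rw [hO]; exact h) hinv'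

omit [Algebra ℚ A] in
/-- **LEMMA 8.1 (b): for orders `Λ_2 ⊆ Λ_1` and `L ∈ G(Λ_2)` (`𝒪(L) = Λ_2`, `L` invertible), `Λ_1L ∈ G(Λ_1)`:
`𝒪(Λ_1L) = Λ_1` and `Λ_1L` is invertible** («`(Λ_1L)L⁻¹ = Λ_1Λ_2 = Λ_1` and `Λ_1(Λ_1L) = Λ_1L` show that `Λ_1L` is
invertible with `𝒪(Λ_1L) = Λ_1`»; `𝒪(Λ_1L) = 𝒪(Λ_1) = Λ_1` is part (a)) — the homomorphism `G(Λ_2) → G(Λ_1)`,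
`L ↦ Λ_1L` (8.1); no fullness hypothesis. [cite: HertlingLarabi2026, §8 Lemma 8.1 (b) (8.1), chunk p0021] -/
theorem div_self_order_mul_eq_of_le {Λ₁ Λ₂ M : Submodule ℤ A} (h1 : (1 : A) ∈ Λ₁) (hΛ₁Λ₁ : Λ₁ * Λ₁ ≤ Λ₁)
    (h2 : (1 : A) ∈ Λ₂) (hle : Λ₂ ≤ Λ₁) (hMO : M / M = Λ₂) (hinv : M * ((M / M) / M) = M / M) :
    (Λ₁ * M) / (Λ₁ * M) = Λ₁ ∧ (Λ₁ * M) * (((Λ₁ * M) / (Λ₁ * M)) / (Λ₁ * M)) = (Λ₁ * M) / (Λ₁ * M) := by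
  have hO₁ : Λ₁ / Λ₁ = Λ₁ := div_self_eq_of_one_mem h1 hΛ₁Λ₁
  have hΛ₁Λ₂ : Λ₁ * Λ₂ = Λ₁ :=
    le_antisymm ((mul_le_mul_right hle _).trans hΛ₁Λ₁) fun x hx => by
      rw [← mul_one x]; exact Submodule.mul_mem_mul hx h2
  have h : M / M ≤ Λ₁ / Λ₁ := by rw [hMO, hO₁]; exact hle
  have hO : (Λ₁ * M) / (Λ₁ * M) = Λ₁ := by rw [div_self_mul_eq_of_div_self_le h hinv, hO₁]
  refine ⟨hO, mul_div_div_eq_of_exists_mul_eq_div_self ⟨(M / M) / M, ?_⟩⟩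
  rw [hO, mul_assoc, hinv, hMO, hΛ₁Λ₂]

omit [Algebra ℚ A] in
/-- The `ε`-class form of LEMMA 8.1 (b): `Λ_1(uL) = u(Λ_1L)`, so `[L]_ε ↦ [Λ_1L]_ε` is well defined —
the homomorphism `G([Λ_2]_ε) → G([Λ_1]_ε)` (8.2). [cite: HertlingLarabi2026, §8 Lemma 8.1 (b) (8.2), chunk p0021] -/
theorem units_smul_order_mul (u : Aˣ) (Λ₁ M : Submodule ℤ A) :
    Λ₁ * (u • M) = u • (Λ₁ * M) := by
  rw [mul_comm Λ₁ (u • M), ← units_smul_mul, mul_comm]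

/-! ## §4 Theorem 8.2 (a): the conductor `C = Λ_2:Λ_1` of a pair of orders `Λ_2 ⊆ Λ_1` -/

omit [Algebra ℚ A] in
/-- **THEOREM 8.2 (a): `𝒪(C) ⊇ Λ_1` for the conductor `C = Λ_2:Λ_1`** («follows from (5.3)»: `𝒪(Λ_2)𝒪(Λ_1) ⊆
𝒪(Λ_2:Λ_1)` with `𝒪(Λ_1) = Λ_1`, `1 ∈ 𝒪(Λ_2)`). [cite: HertlingLarabi2026, §8 Thm. 8.2 (a), chunk p0021] -/
theorem le_div_self_conductor {Λ₁ Λ₂ : Submodule ℤ A} (h1 : (1 : A) ∈ Λ₁) (hΛ₁Λ₁ : Λ₁ * Λ₁ ≤ Λ₁) :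
    Λ₁ ≤ (Λ₂ / Λ₁) / (Λ₂ / Λ₁) := by
  refine Submodule.le_div_iff_mul_le.2 (le_of_eq ?_)
  calc Λ₁ * (Λ₂ / Λ₁) = (Λ₁ / Λ₁) * (Λ₂ / Λ₁) := by rw [div_self_eq_of_one_mem h1 hΛ₁Λ₁]
    _ = Λ₂ / Λ₁ := by rw [mul_comm, div_mul_div_self_eq]

omit [Algebra ℚ A] in
/-- **THEOREM 8.2 (a): `C = Λ_2:Λ_1 ⊆ Λ_2`** («`1_A ∈ Λ_1` implies `C = C·1_A ⊂ C·Λ_1 ⊂ Λ_2`»).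
[cite: HertlingLarabi2026, §8 Thm. 8.2 (a), chunk p0021] [cite: NeukirchANT1999, Ch. I §12, p. 79] -/
theorem conductor_le {Λ₁ Λ₂ : Submodule ℤ A} (h1 : (1 : A) ∈ Λ₁) : Λ₂ / Λ₁ ≤ Λ₂ := fun x hx => by
  simpa using (Submodule.mem_div_iff_forall_mul_mem.1 hx) 1 h1

omit [Algebra ℚ A] in
/-- **THEOREM 8.2 (a): `C` is a `Λ_1`-ideal, `Λ_1·C ⊆ C`.** [cite: HertlingLarabi2026, §8 Thm. 8.2 (a) («So `C` is a `Λ_1`-ideal»), chunk p0021] -/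
theorem conductor_mul_le {Λ₁ Λ₂ : Submodule ℤ A} (h1 : (1 : A) ∈ Λ₁) (hΛ₁Λ₁ : Λ₁ * Λ₁ ≤ Λ₁) :
    Λ₁ * (Λ₂ / Λ₁) ≤ Λ₂ / Λ₁ := by
  rw [← Submodule.le_div_iff_mul_le]
  exact le_div_self_conductor h1 hΛ₁Λ₁

omit [Algebra ℚ A] in
/-- **THEOREM 8.2 (a): the conductor is the BIGGEST `Λ_1`-ideal in `Λ_2`** — every `M ⊆ Λ_2` with `Λ_1M ⊆ M` lies in
`C = Λ_2:Λ_1` («Any `Λ_1`-ideal in `Λ_2` is contained in `Λ_2:Λ_1 = C`»; Neukirch: «the biggest ideal of `𝒪_K`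
which is contained in `𝒪`»). [cite: HertlingLarabi2026, §8 Thm. 8.2 (a), chunk p0021] [cite: NeukirchANT1999, Ch. I §12, p. 79] -/
theorem le_conductor_of_mul_le {Λ₁ Λ₂ M : Submodule ℤ A} (hM : M ≤ Λ₂) (hΛ₁M : Λ₁ * M ≤ M) :
    M ≤ Λ₂ / Λ₁ :=
  Submodule.le_div_iff_mul_le.2 ((mul_comm M Λ₁).le.trans (hΛ₁M.trans hM))

omit [Algebra ℚ A] in
/-- `C = Λ_2` iff `Λ_1 = Λ_2` (for orders `Λ_2 ⊆ Λ_1`): the conductor is all of `Λ_2` exactly when the two orders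
coincide (`Λ_2:Λ_1 = Λ_2 ⟹ Λ_1 = 1·Λ_1 ⊆ Λ_2Λ_1 ⊆ Λ_2`). [cite: HertlingLarabi2026, §8 Thm. 8.2 (a) and (5.14), chunks p0021, p0015] -/
theorem conductor_eq_self_iff {Λ₁ Λ₂ : Submodule ℤ A} (h1 : (1 : A) ∈ Λ₁) (h2 : (1 : A) ∈ Λ₂)
    (hΛ₂Λ₂ : Λ₂ * Λ₂ ≤ Λ₂) (hle : Λ₂ ≤ Λ₁) : Λ₂ / Λ₁ = Λ₂ ↔ Λ₁ = Λ₂ := by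
  constructor
  · intro hC
    refine le_antisymm (fun x hx => ?_) hle
    have h := (Submodule.mem_div_iff_forall_mul_mem.1 (hC.symm ▸ h2 : (1 : A) ∈ Λ₂ / Λ₁)) x hx
    rwa [one_mul] at h
  · rintro rfl
    exact div_self_eq_of_one_mem h1 hΛ₂Λ₂

end LocalUnits

end Literature.NumberTheory.ComplexMultiplication.FiniteQAlgebraLattice
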